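/-
Copyright: the b2b-balaban T⁴-continuum CRUX team, row NE7b OWNER lineage `t4-ne7b-p1` (gen 123). Project licence.
-/
import Summits.QuantumFields.BalabanUV.T4Continuum.Spine.NE7b.SupTorusPointwiseDecayRoad
import Summits.QuantumFields.BalabanUV.T4Continuum.Spine.NE7b.SupTorusPerturbedBlockL1Profile
import Summits.QuantumFields.BalabanUV.T4Continuum.Spine.NE7b.SupTorusPerturbedKernelProfile

/-!
# POINTWISE EXPONENTIAL DECAY OF `(H + K)⁻¹f` ON THE ROAD'S CLASS `−λ ≤ V ≤ Λ`, `d ≥ 3`, FOR SMALL EXPONENTIALLY LOCAL KERNELS: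
# `|K(x,z)| ≤ εe^{−γρ_N(x,z)}` (`γ > 1`, `εK_{γ−1} ≤ (min(2,a) − λ)∕4`), `|f| ≤ M·e^{−γ′ρ_s(bt ·, y₀)}` ⟹ `e^{δρ_s(bt x, y₀)}·|u x| ≤ C·M`
# at EVERY site, `(C, δ)` from `(d, a, λ, Λ, γ, γ′)` and the interior constant `C(d)` only, every mesh, every volume — (154)
# `pointwise_decay_road` RE-RUN INSIDE the interior-estimate argument with the kernel term `Ku` absorbed like the potential term `Vu`
# through (172) `kernel_supProfile_le` (no rate bookkeeping), the block letters from (173) (row NE7b, node U5c; (153)∕(154)∕(167)∕(172)∕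
# (173) BY NAME; [folklore])

Cell `pub-balaban`, sub-cell `t4`, spine estimate NE7b (`T4WeightBudget.RelWeightBound`; the cell's OWN estimate — NOT PRINTED in
[Bałaban 1983–89], NOT PROVED).  Crux-route work under `Spine/NE7b/` by the row OWNER (`t4-ne7b-p1` gen 123, file (174)) under FREEZE
(0)'s crux-prover clause; NOTHING of Bałaban's is named as a Lean object, valued or asserted; no `T4Continuum/Support` leaf typed; no `def`,
no notation (the action `(H + K)u` DISPLAYED exactly as in (162)–(173)); zero `sorry`.  Imports (BY NAME): the OWNER's (154)
`…SupTorusPointwiseDecayRoad` (through it (153) `near_dist_le`, `sum_cube_le_of_near`, (151) `lap_lift`, `blk_near_of_mem_cube`, (132)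
`isPseudoDist_torus`, (131) `exists_rate`, the torus dictionary and the β-team's `Beta.PoissonInterior.interior_estimate` — the
inhomogeneous interior estimate for the lattice Poisson equation on `ℤ^d`, `d ≥ 3`, [folklore]), (173) `…SupTorusPerturbedBlockL1Profile`
(`perturbed_blockL1_le_of_supProfile`, `perturbed_blockMean_le_of_supProfile`, `perturbed_laplacian_site_le`), (172)
`…SupTorusPerturbedKernelProfile` (`kernel_supProfile_le`; through it (168) `kernelSum_anti`).

WHY (located).  (170) gave the `ℓ^∞` BOUND of `(H + K)⁻¹` by perturbing (152), but the pointwise DECAY does not follow that way: (154)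
returns the rate `min(κ, γ′∕2)` for a source of rate `γ′`, so `Hu = f − Ku` in a weighted sup norm loses rate at each pass and never
closes.  Here the decay is re-run INSIDE (154)'s argument.  At the maximum `x₀` of the weighted modulus `e^{δρ_s(bt x, y₀)}|u x|` (value
`S`), `|u| ≤ Se^{−δρ_s(bt ·, y₀)}` everywhere, so by (172) `|Ku| ≤ εK_{γ−δ}e^{2dδ}·S·e^{−δρ_s(bt ·, y₀)}` — the kernel term has EXACTLY the
shape of the zeroth-order term `|Vu| ≤ (|λ| + Λ)·S·e^{−δρ}`, and enters the bound of `|Δ(u∘σ)|` on the cube of radius `3m`, `m = ⌊θ(n+1)⌋`,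
with `L = |λ| + Λ` replaced by `L′ = L + εK_{γ−δ}e^{2dδ}`; the block-`ℓ¹` norms and block means carry the profile by (173); `θ` with
`C(d)e^{dδ}θ²L′ ≤ 1∕4` absorbs.  The kernel smallness `εK_{γ−1} ≤ (min(2,a) − λ)∕4` is (166)'s (so the file composes with
`perturbed_nextScale_hessian_local` under ONE hypothesis): with (131)'s rate `m_κ ≥ (min(2,a) − λ)∕2` and `δ ≤ κ ≤ 1 < γ`, the perturbed
floor at the rate `δ` is `m_δ − εK_{γ−δ} ≥ (min(2,a) − λ)∕4`.

WHAT IS PROVED ([folklore]; fine torus `Site d ((n+1)s)`, coarse `Site d s`, `[NeZero s]`; `(H + K)u` DISPLAYED; `σ = siteOf`, `bt x =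
σ_s(blk n (wm x))`, `ρ_s` the `ℓ¹` circular distance; `K_α = (2∕(1 − e^{−α}))^d`):
* §1 THE HEADLINE **`perturbed_pointwise_decay`**: `d ≥ 3`, `a > 0`, `λ < min(2,a)`, `Λ ≥ 0`, `γ′ > 0`, `ε ≥ 0`, `γ > 1`, `εK_{γ−1} ≤
  (min(2,a) − λ)∕4` ⟹ `∃ C δ > 0` such that for ALL `n, s`, ALL `−λ ≤ V ≤ Λ`, ALL kernels `|K(x,z)| ≤ εe^{−γρ_N(x,z)}` (no symmetry needed),
  every block `y₀`, EVERY `f` with `|f x| ≤ M·e^{−γ′ρ_s(bt x, y₀)}` and every `(H + K)u = f`: `e^{δρ_s(bt x, y₀)}·|u x| ≤ C·M` at EVERY site.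
* §2 toy.

HONEST (what this is NOT).  `d ≥ 3` only (transience behind `interior_estimate`); `C` inherits lit1's existential Green-function
constants; rates far from sharp (`δ = min(κ, γ′∕2)`); SMALL kernels with the exact lattice Laplacian as main part — the O(1) coarse kernel ∕
non-Laplacian main part the road's own step produces (§ [NE7bP1-G122-HANDOFF] (3)(b)) is NOT covered; cubic periods; scalar skeleton ((A3),
NC-NE7b-α UNRULED); nothing of the covariant propagators of [B4]–[B6]; nothing of Bałaban's.  BY-NAME EFFECT ON THE WALL: NONE.  NE7b NOT
PRINTED ∕ NOT PROVED; spine PROVED 0∕9; rung (B)+1 on a FINITE torus — NOT infinite volume, NOT the mass gap, NOT Clay.  HONEST DEPENDENCY: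
continuum YM on T⁴ ⇐ BetaPertH ∧ nine spine estimates (0∕9 proved); BetaPertH ⇐ (D1) ∧ (D4) ∧ CAP+tail; G-an2-4 gates asym, D1 and NE2∕3∕4.
-/

set_option autoImplicit false

noncomputable section

namespace Summit.QuantumFields.BalabanUV.T4Continuum.NE7b.SupTorusPerturbedPointwiseDecay

open Real
open Literature.MathematicalPhysics.QuantumFieldTheory.Balaban1983to89
open Literature.Probability.LatticeModels (latticeLaplacianZd)
open B6QGQLower276 (X e blk B side chart mem_B sum_B sum_B_const card_cube blk_chart)
open Beta (Site siteOf windowMap siteOf_windowMap siteOf_add siteOf_sub)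
open Beta.PoissonInterior (cube mem_cube interior_estimate)
open SupTorusDirichletForm (siteOf_chart_surjective blockOf_siteOf_of_mem blockOf_siteOf)
open SupTorusDirichletFormCoercive (comp_siteOf_periodic)
open PeriodicSupTorusCarrier (exists_windowMap_siteOf)
open OneShotChartTorusRowsZd (sum_B_translate)
open SupTorusHessianCombesThomas (exists_rate)
open SupTorusBlockDistance (isPseudoDist_torus)
open SupTorusBlockL1Letter (lap_lift blk_near_of_mem_cube)
open SupTorusBlockL1Profile (near_dist_le sum_cube_le_of_near)
open SupTorusPerturbedResponse (kernelSum_anti)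
open SupTorusPerturbedKernelProfile (kernel_supProfile_le)
open SupTorusPerturbedBlockL1Profile (perturbed_blockL1_le_of_supProfile perturbed_blockMean_le_of_supProfile
  perturbed_laplacian_site_le)

variable {d : ℕ}

/-! ## §1. THE END: pointwise exponential decay of `(H + K)⁻¹f` on the road's class, every mesh, every volume -/

set_option maxHeartbeats 400000 in
/-- **HEADLINE — `|f| ≤ M·e^{−γ′ρ_s(bt ·, y₀)}` ⟹ `e^{δρ_s(bt x, y₀)}·|(H_V + K)⁻¹f|(x) ≤ C·M` AT EVERY SITE, ON THE ROAD'S CLASS `−λ ≤ V ≤ Λ`,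
FOR EVERY KERNEL `|K(x,z)| ≤ εe^{−γρ_N(x,z)}` WITH `γ > 1`, `εK_{γ−1} ≤ (min(2,a) − λ)∕4` ((166)'s smallness), `d ≥ 3`, every mesh, every
volume** — `(C, δ)` functions of `(d, a, λ, Λ, γ, γ′)` and the interior constant `C(d)` only; EVERY source with that profile; no symmetry of
`K` needed.  (154)'s interior-regularity argument on the periodic lift at the radius `3m`, `m = ⌊θ(n+1)⌋`, about a representative of the
maximum `x₀` of the weighted modulus, with the kernel term `|Ku| ≤ εK_{γ−δ}e^{2dδ}Se^{−δρ_s}` ((172)) entering like `|Vu| ≤ (|λ| + Λ)Se^{−δρ_s}`: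
`θ` is chosen with `C(d)e^{dδ}θ²(|λ| + Λ + εK_{γ−δ}e^{2dδ}) ≤ 1∕4`; block letters from (173); meshes with `θ(n+1) < 2` read off (173) directly.
§ [NE7bP1-G122-HANDOFF] NEXT (3)(a), with NO hypothesis left. [folklore] -/
theorem perturbed_pointwise_decay (hd : 3 ≤ d) (a : ℝ) (ha : 0 < a) {lam Lam ε γ γ' : ℝ} (hlam : lam < min 2 a) (hLam : 0 ≤ Lam)
    (hγ' : 0 < γ') (hε : 0 ≤ ε) (hγ : 1 < γ) (hεs : ε * (2 * (1 - exp (-(γ - 1)))⁻¹) ^ d ≤ (min 2 a - lam) / 4) :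
    ∃ C δ : ℝ, 0 < C ∧ 0 < δ ∧ ∀ (n s : ℕ) [NeZero s] (V : Site d ((n + 1) * s) → ℝ), (∀ x, -lam ≤ V x) → (∀ x, V x ≤ Lam) →
      ∀ K : Site d ((n + 1) * s) → Site d ((n + 1) * s) → ℝ,
      (∀ x z, |K x z| ≤ ε * exp (-(γ * ∑ i, (((x i - z i).valMinAbs.natAbs : ℕ) : ℝ)))) →
      ∀ (y₀ : Site d s) (M : ℝ) (u f : Site d ((n + 1) * s) → ℝ),
      (∀ x, |f x| ≤ M * exp (-(γ' * ∑ i, ((((siteOf d s (blk n (windowMap d ((n + 1) * s) x))) i - y₀ i).valMinAbs.natAbs : ℕ) : ℝ)))) →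
      (∀ x, ((n : ℝ) + 1) ^ 2 * ∑ μ, (2 * u x - u (x + siteOf d ((n + 1) * s) (e μ)) - u (x - siteOf d ((n + 1) * s) (e μ)))
        + a / ((n : ℝ) + 1) ^ d * ∑ q ∈ B n (blk n (windowMap d ((n + 1) * s) x)), u (siteOf d ((n + 1) * s) q) + V x * u x
        + ∑ z, K x z * u z = f x) →
      ∀ x : Site d ((n + 1) * s),
        exp (δ * ∑ i, ((((siteOf d s (blk n (windowMap d ((n + 1) * s) x))) i - y₀ i).valMinAbs.natAbs : ℕ) : ℝ)) * |u x| ≤ C * M := by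
  classical
  have hdR : (0 : ℝ) ≤ d := Nat.cast_nonneg d
  have hm0 : 0 < min 2 a - lam := by linarith
  obtain ⟨κ, hκ0, hκ1, hκm⟩ := exists_rate (d := d) a ha.le hm0
  -- the rate `δ = min(κ, γ′∕2)` and the perturbed floor at the rate `δ`
  set δ : ℝ := min κ (γ' / 2) with hδ_def
  have hδ0 : 0 < δ := lt_min hκ0 (by linarith)
  have hδκ : δ ≤ κ := min_le_left _ _
  have h2δ : 2 * δ ≤ γ' := by have := min_le_right κ (γ' / 2); rw [← hδ_def] at this; linarith
  have hδ1 : δ ≤ 1 := hδκ.trans hκ1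
  have hδγ : δ < γ := lt_of_le_of_lt hδ1 hγ
  have hmono1 : δ ^ 2 ≤ κ ^ 2 := pow_le_pow_left₀ hδ0.le hδκ 2
  have hmono2 : exp (2 * d * δ) ≤ exp (2 * d * κ) := exp_le_exp.2 (by nlinarith)
  have hmδ : (min 2 a - lam) / 2 ≤ min 2 a - lam - 2 * d * δ ^ 2 - a * (exp (2 * d * δ) - 1) := by nlinarith
  set Kγδ : ℝ := (2 * (1 - exp (-(γ - δ)))⁻¹) ^ d with hKγδ
  have hKγδ0 : 0 ≤ Kγδ := pow_nonneg (mul_nonneg zero_le_two (inv_nonneg.2 (sub_nonneg.2 (exp_le_one_iff.2 (by linarith))))) d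
  have hKmono : Kγδ ≤ (2 * (1 - exp (-(γ - 1)))⁻¹) ^ d := kernelSum_anti (d := d) (by linarith) (by linarith)
  have hεδ : ε * Kγδ ≤ (min 2 a - lam) / 4 := (mul_le_mul_of_nonneg_left hKmono hε).trans hεs
  have hfl : ε * (2 * (1 - exp (-(γ - δ)))⁻¹) ^ d < min 2 a - lam - 2 * d * δ ^ 2 - a * (exp (2 * d * δ) - 1) := by
    rw [← hKγδ]; linarith
  have hfl4 : (min 2 a - lam) / 4 ≤ min 2 a - lam - 2 * d * δ ^ 2 - a * (exp (2 * d * δ) - 1) - ε * (2 * (1 - exp (-(γ - δ)))⁻¹) ^ d := by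
    rw [← hKγδ]; linarith
  set mδ : ℝ := min 2 a - lam - 2 * d * δ ^ 2 - a * (exp (2 * d * δ) - 1) - ε * (2 * (1 - exp (-(γ - δ)))⁻¹) ^ d with hmδ_def
  have hmδpos : 0 < mδ := lt_of_lt_of_le (by positivity) hfl4
  have hminv : 0 ≤ mδ⁻¹ := inv_nonneg.2 hmδpos.le
  -- the constants
  set K2 : ℝ := (2 * (1 - exp (-(2 * δ)))⁻¹) ^ d with hK2
  have hK20 : 0 ≤ K2 := pow_nonneg (mul_nonneg zero_le_two (inv_nonneg.2 (sub_nonneg.2 (exp_le_one_iff.2 (by linarith))))) d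
  set Cd : ℝ := mδ⁻¹ * exp (2 * d * δ) * K2 with hCd
  have hCd0 : 0 ≤ Cd := by positivity
  set Kk : ℝ := ε * Kγδ * exp (2 * d * δ) with hKk
  have hKk0 : 0 ≤ Kk := by positivity
  set E : ℝ := exp (d * δ) with hE
  have hE1 : 1 ≤ E := one_le_exp (by positivity)
  obtain ⟨CI, hCI0, hI⟩ := interior_estimate hd
  set L : ℝ := |lam| + Lam with hL
  have hL0 : 0 ≤ L := by positivity
  set L' : ℝ := L + Kk with hL'
  have hL'0 : 0 ≤ L' := by positivity
  set θ : ℝ := min (1 / 3) (1 / (4 * (CI * L' * E + 1))) with hθ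
  have hθ0 : 0 < θ := lt_min (by norm_num) (by positivity)
  have hθ3 : θ ≤ 1 / 3 := min_le_left _ _
  have hθabs : CI * L' * E * θ ^ 2 ≤ 1 / 4 := by
    have h1 : θ ≤ 1 / (4 * (CI * L' * E + 1)) := min_le_right _ _
    have h2 : θ ^ 2 ≤ θ * (1 / (4 * (CI * L' * E + 1))) := by rw [sq]; exact mul_le_mul_of_nonneg_left h1 hθ0.le
    have h3 : CI * L' * E * (θ * (1 / (4 * (CI * L' * E + 1)))) = θ / 4 * (CI * L' * E / (CI * L' * E + 1)) := by field_simp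
    have h4 : CI * L' * E / (CI * L' * E + 1) ≤ 1 := by rw [div_le_one (by positivity)]; linarith
    calc CI * L' * E * θ ^ 2 ≤ CI * L' * E * (θ * (1 / (4 * (CI * L' * E + 1)))) := mul_le_mul_of_nonneg_left h2 (by positivity)
      _ = θ / 4 * (CI * L' * E / (CI * L' * E + 1)) := h3
      _ ≤ θ / 4 * 1 := mul_le_mul_of_nonneg_left h4 (by positivity)
      _ ≤ 1 / 4 := by linarith [hθ3]
  set K₁ : ℝ := (2 / θ) ^ d * Cd with hK₁
  set K₂ : ℝ := 2 * (CI * E) * (θ ^ 2 * (1 + a * Cd) + 3 ^ d * Cd * (2 / θ) ^ d) with hK₂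
  have hK₁0 : 0 ≤ K₁ := by positivity
  have hK₂0 : 0 ≤ K₂ := by positivity
  refine ⟨max K₁ K₂ + 1, δ, by positivity, hδ0, ?_⟩
  intro n s _ V hV hV' K hK y₀ M u f hf hu x
  have hP := isPseudoDist_torus (d := d) s
  have hM : 0 ≤ M := by
    have h1 := (abs_nonneg _).trans (hf x)
    exact le_of_mul_le_mul_right (by rw [zero_mul]; exact h1) (exp_pos _)
  have hn1 : (0 : ℝ) < (n : ℝ) + 1 := by positivity
  have hvol : (0 : ℝ) < ((n : ℝ) + 1) ^ d := by positivity
  have hVabs : ∀ x', |V x'| ≤ L := fun x' => by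
    rw [hL, abs_le]; constructor <;> linarith [hV x', hV' x', le_abs_self lam, neg_abs_le lam]
  -- block means and block `ℓ¹` norms carry the profile `e^{−δρ_s(·, y₀)}` ((173) at the rate `δ`)
  have hmean : ∀ y : Site d s, |(((n : ℝ) + 1) ^ d)⁻¹ * ∑ z : Fin d → Fin (n + 1), u (siteOf d ((n + 1) * s) (chart n (windowMap d s y) z))|
      ≤ Cd * M * exp (-(δ * ∑ i, (((y i - y₀ i).valMinAbs.natAbs : ℕ) : ℝ))) := fun y => by
    have h := perturbed_blockMean_le_of_supProfile n a s ha.le hδ0 hδ1 hδγ hε hfl h2δ V hV K hK y₀ u f hf hu y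
    rw [hCd]; linarith [h]
  have hL1 : ∀ b : X d, ∑ q ∈ B n b, |u (siteOf d ((n + 1) * s) q)|
      ≤ ((n : ℝ) + 1) ^ d * Cd * M * exp (-(δ * ∑ i, ((((siteOf d s b) i - y₀ i).valMinAbs.natAbs : ℕ) : ℝ))) := fun b => by
    have h := perturbed_blockL1_le_of_supProfile n a s ha.le hδ0 hδ1 hδγ hε hfl h2δ V hV K hK y₀ u f hf hu (siteOf d s b)
    obtain ⟨t, ht⟩ := exists_windowMap_siteOf s b
    rw [← sum_B (windowMap d s (siteOf d s b)) (fun q => |u (siteOf d ((n + 1) * s) q)|), ht, sum_B_translate] at h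
    simp only [comp_siteOf_periodic] at h
    rw [hCd]; linarith [h]
  -- the maximum of the weighted modulus
  obtain ⟨x₀, hx₀⟩ := Finite.exists_max fun x' : Site d ((n + 1) * s) =>
    exp (δ * ∑ i, ((((siteOf d s (blk n (windowMap d ((n + 1) * s) x'))) i - y₀ i).valMinAbs.natAbs : ℕ) : ℝ)) * |u x'|
  set ρ₀ : ℝ := ∑ i, ((((siteOf d s (blk n (windowMap d ((n + 1) * s) x₀))) i - y₀ i).valMinAbs.natAbs : ℕ) : ℝ) with hρ₀
  set S : ℝ := exp (δ * ρ₀) * |u x₀| with hS_def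
  have hS0 : 0 ≤ S := by positivity
  have hSx : ∀ x', |u x'| ≤ exp (-(δ * ∑ i, ((((siteOf d s (blk n (windowMap d ((n + 1) * s) x'))) i - y₀ i).valMinAbs.natAbs : ℕ) : ℝ)))
      * S := fun x' => by
    have h := hx₀ x'
    rw [exp_neg, ← div_eq_inv_mul, le_div_iff₀ (exp_pos _), mul_comm]
    exact h
  have hSx' : ∀ x', |u x'| ≤ S * exp (-(δ * ∑ i, ((((siteOf d s (blk n (windowMap d ((n + 1) * s) x'))) i - y₀ i).valMinAbs.natAbs : ℕ) : ℝ))) :=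
    fun x' => by rw [mul_comm]; exact hSx x'
  -- the kernel term has the profile of `u` ((172))
  have hKu : ∀ x', |∑ z, K x' z * u z|
      ≤ Kk * S * exp (-(δ * ∑ i, ((((siteOf d s (blk n (windowMap d ((n + 1) * s) x'))) i - y₀ i).valMinAbs.natAbs : ℕ) : ℝ))) :=
    fun x' => by
    have h := kernel_supProfile_le n s hε hδ0.le hδγ K hK y₀ u hSx' x'
    rw [hKk, hKγδ]
    calc _ ≤ _ := h
      _ = _ := by ring
  suffices hmain : S ≤ max K₁ K₂ * M by
    calc _ ≤ S := hx₀ x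
      _ ≤ max K₁ K₂ * M := hmain
      _ ≤ (max K₁ K₂ + 1) * M := by rw [add_mul, one_mul]; linarith
  -- the block of `x₀` through the chart
  obtain ⟨⟨y, z⟩, hyz⟩ := siteOf_chart_surjective n s x₀
  simp only at hyz
  have hbt : siteOf d s (blk n (windowMap d ((n + 1) * s) x₀)) = y := by
    rw [← hyz]; exact blockOf_siteOf_of_mem n s (mem_B.2 (blk_chart n (windowMap d s y) z))
  have hρ₀y : ρ₀ = ∑ i, (((y i - y₀ i).valMinAbs.natAbs : ℕ) : ℝ) := by rw [hρ₀, hbt]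
  by_cases hsmall : θ * ((n : ℝ) + 1) < 2
  · -- small meshes
    have h1 : |u x₀| ≤ ∑ z' : Fin d → Fin (n + 1), |u (siteOf d ((n + 1) * s) (chart n (windowMap d s y) z'))| := by
      rw [← hyz]
      exact Finset.single_le_sum (f := fun z' => |u (siteOf d ((n + 1) * s) (chart n (windowMap d s y) z'))|)
        (fun _ _ => abs_nonneg _) (Finset.mem_univ z)
    have h2 : ∑ z' : Fin d → Fin (n + 1), |u (siteOf d ((n + 1) * s) (chart n (windowMap d s y) z'))|
        ≤ ((n : ℝ) + 1) ^ d * Cd * M * exp (-(δ * ∑ i, (((y i - y₀ i).valMinAbs.natAbs : ℕ) : ℝ))) := by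
      have h := perturbed_blockL1_le_of_supProfile n a s ha.le hδ0 hδ1 hδγ hε hfl h2δ V hV K hK y₀ u f hf hu y
      rw [hCd]; linarith [h]
    have h3 : ((n : ℝ) + 1) ^ d ≤ (2 / θ) ^ d := by
      refine pow_le_pow_left₀ hn1.le ?_ d
      rw [le_div_iff₀ hθ0]; linarith
    have h4 : exp (δ * ρ₀) * exp (-(δ * ∑ i, (((y i - y₀ i).valMinAbs.natAbs : ℕ) : ℝ))) = 1 := by
      rw [← exp_add, hρ₀y, add_neg_cancel, exp_zero]
    calc S = exp (δ * ρ₀) * |u x₀| := rfl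
      _ ≤ exp (δ * ρ₀) * (((n : ℝ) + 1) ^ d * Cd * M * exp (-(δ * ∑ i, (((y i - y₀ i).valMinAbs.natAbs : ℕ) : ℝ)))) :=
          mul_le_mul_of_nonneg_left (h1.trans h2) (exp_pos _).le
      _ = ((n : ℝ) + 1) ^ d * Cd * M * (exp (δ * ρ₀) * exp (-(δ * ∑ i, (((y i - y₀ i).valMinAbs.natAbs : ℕ) : ℝ)))) := by ring
      _ = ((n : ℝ) + 1) ^ d * Cd * M := by rw [h4, mul_one]
      _ ≤ (2 / θ) ^ d * Cd * M := mul_le_mul_of_nonneg_right (mul_le_mul_of_nonneg_right h3 hCd0) hM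
      _ = K₁ * M := by rw [hK₁]
      _ ≤ max K₁ K₂ * M := mul_le_mul_of_nonneg_right (le_max_left _ _) hM
  · -- large meshes: interior regularity with exponential weights
    have hsmall' : 2 ≤ θ * ((n : ℝ) + 1) := not_lt.1 hsmall
    set mm : ℕ := ⌊θ * ((n : ℝ) + 1)⌋₊ with hmm
    have hmm_le : (mm : ℝ) ≤ θ * ((n : ℝ) + 1) := Nat.floor_le (by positivity)
    have hmm_ge : θ * ((n : ℝ) + 1) / 2 ≤ mm := by
      have := Nat.lt_floor_add_one (θ * ((n : ℝ) + 1))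
      rw [← hmm] at this
      linarith
    have hmm2 : 2 ≤ mm := Nat.le_floor (by exact_mod_cast hsmall')
    have hmm1 : 1 ≤ mm := le_trans (by norm_num) hmm2
    have hmmR : (0 : ℝ) < mm := by exact_mod_cast (lt_of_lt_of_le zero_lt_one hmm1)
    have h3m : 3 * mm ≤ n + 1 := by
      have h : ((3 * mm : ℕ) : ℝ) ≤ ((n + 1 : ℕ) : ℝ) := by
        push_cast
        have := mul_le_mul_of_nonneg_right hθ3 hn1.le
        linarith
      exact_mod_cast h
    set q₀ : X d := windowMap d ((n + 1) * s) x₀ with hq₀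
    have hy0 : siteOf d s (blk n q₀) = y := hbt
    -- every near block is within `ρ_s`-distance `d` of `y`: its profile factor is `≤ e^{dδ}e^{−δρ₀}`
    have hnear : ∀ b : X d, (∀ i, blk n q₀ i - 1 ≤ b i ∧ b i ≤ blk n q₀ i + 1) →
        exp (-(δ * ∑ i, ((((siteOf d s b) i - y₀ i).valMinAbs.natAbs : ℕ) : ℝ))) ≤ E * exp (-(δ * ρ₀)) := fun b hb => by
      have hdist : ∑ i, ((((siteOf d s b) i - (siteOf d s (blk n q₀)) i).valMinAbs.natAbs : ℕ) : ℝ) ≤ d := near_dist_le s hb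
      rw [hy0] at hdist
      have htri : ∑ i, (((y i - y₀ i).valMinAbs.natAbs : ℕ) : ℝ)
          ≤ ∑ i, (((y i - (siteOf d s b) i).valMinAbs.natAbs : ℕ) : ℝ) + ∑ i, ((((siteOf d s b) i - y₀ i).valMinAbs.natAbs : ℕ) : ℝ) :=
        hP.triangle y (siteOf d s b) y₀
      have hsymm : ∑ i, (((y i - (siteOf d s b) i).valMinAbs.natAbs : ℕ) : ℝ) = ∑ i, ((((siteOf d s b) i - y i).valMinAbs.natAbs : ℕ) : ℝ) :=
        hP.symm y (siteOf d s b)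
      rw [hE, ← exp_add, hρ₀y]
      refine exp_le_exp.2 ?_
      rw [hsymm] at htri
      have k1 := mul_le_mul_of_nonneg_left htri hδ0.le
      have k2 := mul_le_mul_of_nonneg_left hdist hδ0.le
      linarith
    obtain ⟨A, hA⟩ : ∃ A : ℝ, A = E * exp (-(δ * ρ₀)) * (M + L' * S + a * (Cd * M)) / ((n : ℝ) + 1) ^ 2 := ⟨_, rfl⟩
    obtain ⟨Bsum, hB⟩ : ∃ Bsum : ℝ, Bsum = 3 ^ d * (((n : ℝ) + 1) ^ d * Cd * M * (E * exp (-(δ * ρ₀)))) := ⟨_, rfl⟩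
    have hlap : ∀ p ∈ cube q₀ (3 * mm), |latticeLaplacianZd (fun p' : X d => u (siteOf d ((n + 1) * s) p')) p| ≤ A := by
      intro p hp
      rw [lap_lift, abs_neg]
      obtain ⟨⟨y', z'⟩, hyz'⟩ := siteOf_chart_surjective n s (siteOf d ((n + 1) * s) p)
      simp only at hyz'
      have hbt' : siteOf d s (blk n (windowMap d ((n + 1) * s) (siteOf d ((n + 1) * s) p))) = y' := by
        rw [← hyz']; exact blockOf_siteOf_of_mem n s (mem_B.2 (blk_chart n (windowMap d s y') z'))
      have hy'b : y' = siteOf d s (blk n p) := by rw [← hbt', blockOf_siteOf]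
      have hw : exp (-(δ * ∑ i, (((y' i - y₀ i).valMinAbs.natAbs : ℕ) : ℝ))) ≤ E * exp (-(δ * ρ₀)) := by
        rw [hy'b]; exact hnear (blk n p) (blk_near_of_mem_cube h3m hp)
      have hfx := hf (siteOf d ((n + 1) * s) p)
      have hux := hSx (siteOf d ((n + 1) * s) p)
      have hKx := hKu (siteOf d ((n + 1) * s) p)
      rw [hbt'] at hfx hux hKx
      rw [← hyz'] at hfx hux hKx ⊢
      have hρ' : 0 ≤ ∑ i, (((y' i - y₀ i).valMinAbs.natAbs : ℕ) : ℝ) := Finset.sum_nonneg fun _ _ => Nat.cast_nonneg _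
      have hγδ : exp (-(γ' * ∑ i, (((y' i - y₀ i).valMinAbs.natAbs : ℕ) : ℝ))) ≤ exp (-(δ * ∑ i, (((y' i - y₀ i).valMinAbs.natAbs : ℕ) : ℝ))) := by
        refine exp_le_exp.2 ?_
        have hδγ' : δ ≤ γ' := by linarith
        have := mul_le_mul_of_nonneg_right hδγ' hρ'
        linarith
      have k1 : |f (siteOf d ((n + 1) * s) (chart n (windowMap d s y') z'))| ≤ M * (E * exp (-(δ * ρ₀))) :=
        hfx.trans ((mul_le_mul_of_nonneg_left hγδ hM).trans (mul_le_mul_of_nonneg_left hw hM))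
      have k2 : |u (siteOf d ((n + 1) * s) (chart n (windowMap d s y') z'))| ≤ E * exp (-(δ * ρ₀)) * S :=
        hux.trans (mul_le_mul_of_nonneg_right hw hS0)
      have k3 : |(((n : ℝ) + 1) ^ d)⁻¹ * ∑ z : Fin d → Fin (n + 1), u (siteOf d ((n + 1) * s) (chart n (windowMap d s y') z))|
          ≤ Cd * M * (E * exp (-(δ * ρ₀))) := (hmean y').trans (mul_le_mul_of_nonneg_left hw (by positivity))
      have k4 : |∑ z, K (siteOf d ((n + 1) * s) (chart n (windowMap d s y') z')) z * u z| ≤ Kk * (E * exp (-(δ * ρ₀)) * S) :=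
        calc _ ≤ Kk * S * exp (-(δ * ∑ i, (((y' i - y₀ i).valMinAbs.natAbs : ℕ) : ℝ))) := hKx
          _ = Kk * (exp (-(δ * ∑ i, (((y' i - y₀ i).valMinAbs.natAbs : ℕ) : ℝ))) * S) := by ring
          _ ≤ Kk * (E * exp (-(δ * ρ₀)) * S) := mul_le_mul_of_nonneg_left (mul_le_mul_of_nonneg_right hw hS0) hKk0
      rw [hA]
      exact perturbed_laplacian_site_le n a s ha.le hL0 V u f K hu y' z' (hVabs _) k1 k2 k3 k4
    have hl1 : ∑ p ∈ cube q₀ (3 * mm), |u (siteOf d ((n + 1) * s) p)| ≤ Bsum := by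
      rw [hB]
      refine sum_cube_le_of_near h3m q₀ (F := fun p => |u (siteOf d ((n + 1) * s) p)|) (fun _ => abs_nonneg _) fun b hb => ?_
      exact (hL1 b).trans (mul_le_mul_of_nonneg_left (hnear b hb) (by positivity))
    have hint0 := (hI mm hmm1 (fun p' : X d => u (siteOf d ((n + 1) * s) p')) q₀ A Bsum hlap hl1).1
    have e2 : siteOf d ((n + 1) * s) q₀ = x₀ := by rw [hq₀, siteOf_windowMap]
    have hint : |u x₀| ≤ CI * ((mm : ℝ) ^ 2 * A + Bsum / (mm : ℝ) ^ d) := by rw [← e2]; exact hint0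
    have hX0 : 0 ≤ M + L' * S + a * (Cd * M) := by positivity
    have hmA : (mm : ℝ) ^ 2 * A ≤ E * exp (-(δ * ρ₀)) * (θ ^ 2 * (M + L' * S + a * (Cd * M))) := by
      have h1 : (mm : ℝ) ^ 2 ≤ θ ^ 2 * ((n : ℝ) + 1) ^ 2 := by
        rw [← mul_pow]; exact pow_le_pow_left₀ hmmR.le hmm_le 2
      have h2 : (mm : ℝ) ^ 2 / ((n : ℝ) + 1) ^ 2 ≤ θ ^ 2 := by rwa [div_le_iff₀ (by positivity)]
      calc (mm : ℝ) ^ 2 * A = E * exp (-(δ * ρ₀)) * ((mm : ℝ) ^ 2 / ((n : ℝ) + 1) ^ 2 * (M + L' * S + a * (Cd * M))) := by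
            rw [hA]; ring
        _ ≤ _ := mul_le_mul_of_nonneg_left (mul_le_mul_of_nonneg_right h2 hX0) (by positivity)
    have hmB : Bsum / (mm : ℝ) ^ d ≤ E * exp (-(δ * ρ₀)) * (3 ^ d * Cd * (2 / θ) ^ d * M) := by
      have hr : (n : ℝ) + 1 ≤ 2 / θ * mm := by
        rw [div_mul_eq_mul_div, le_div_iff₀ hθ0]; linarith
      have h1 : ((n : ℝ) + 1) ^ d ≤ (2 / θ) ^ d * (mm : ℝ) ^ d := by
        rw [← mul_pow]; exact pow_le_pow_left₀ hn1.le hr d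
      have h2 : ((n : ℝ) + 1) ^ d / (mm : ℝ) ^ d ≤ (2 / θ) ^ d := by rwa [div_le_iff₀ (by positivity)]
      calc Bsum / (mm : ℝ) ^ d = E * exp (-(δ * ρ₀)) * (3 ^ d * Cd * M * (((n : ℝ) + 1) ^ d / (mm : ℝ) ^ d)) := by rw [hB]; ring
        _ ≤ E * exp (-(δ * ρ₀)) * (3 ^ d * Cd * M * (2 / θ) ^ d) :=
            mul_le_mul_of_nonneg_left (mul_le_mul_of_nonneg_left h2 (by positivity)) (by positivity)
        _ = _ := by ring
    -- multiply by the weight and absorb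
    have hw0 : exp (δ * ρ₀) * exp (-(δ * ρ₀)) = 1 := by rw [← exp_add, add_neg_cancel, exp_zero]
    have hS1 : S ≤ CI * E * (θ ^ 2 * (M + L' * S + a * (Cd * M)) + 3 ^ d * Cd * (2 / θ) ^ d * M) := by
      have h := mul_le_mul_of_nonneg_left (hint.trans (mul_le_mul_of_nonneg_left (add_le_add hmA hmB) hCI0)) (exp_pos (δ * ρ₀)).le
      have e : exp (δ * ρ₀) * (CI * (E * exp (-(δ * ρ₀)) * (θ ^ 2 * (M + L' * S + a * (Cd * M)))
          + E * exp (-(δ * ρ₀)) * (3 ^ d * Cd * (2 / θ) ^ d * M)))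
          = (exp (δ * ρ₀) * exp (-(δ * ρ₀))) * (CI * E * (θ ^ 2 * (M + L' * S + a * (Cd * M)) + 3 ^ d * Cd * (2 / θ) ^ d * M)) := by
        ring
      rw [e, hw0, one_mul] at h
      exact h
    have hS2 : S ≤ (1 / 4) * S + (K₂ / 2) * M := by
      have e : CI * E * (θ ^ 2 * (M + L' * S + a * (Cd * M)) + 3 ^ d * Cd * (2 / θ) ^ d * M)
          = CI * L' * E * θ ^ 2 * S + (K₂ / 2) * M := by rw [hK₂]; ring
      rw [e] at hS1
      have h4 := mul_le_mul_of_nonneg_right hθabs hS0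
      linarith
    have hS3 : S ≤ K₂ * M := by
      have : 0 ≤ K₂ * M := by positivity
      linarith
    exact hS3.trans (mul_le_mul_of_nonneg_right (le_max_right _ _) hM)

/-! ## §2. Toy -/

/-- Toy (`d = 3`, `a = 1`, `λ = 0`, `Λ = 1`, `γ′ = 1`, `ε = 0`, `γ = 2`): the headline's hypotheses are inhabited, so the constants exist. -/
example : ∃ C δ : ℝ, 0 < C ∧ 0 < δ :=
  let ⟨C, δ, hC, hδ, _⟩ := perturbed_pointwise_decay (d := 3) le_rfl 1 one_pos (lam := 0) (Lam := 1) (ε := 0) (γ := 2) (γ' := 1)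
    (by rw [min_eq_right (by norm_num : (1 : ℝ) ≤ 2)]; norm_num) zero_le_one one_pos le_rfl (by norm_num)
    (by rw [min_eq_right (by norm_num : (1 : ℝ) ≤ 2)]; norm_num)
  ⟨C, δ, hC, hδ⟩

end Summit.QuantumFields.BalabanUV.T4Continuum.NE7b.SupTorusPerturbedPointwiseDecay
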